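import Literature.Probability.LatticeModels.LatticeGreenRiemannSum
import HarnessLib

/-!
# Riemann sums of continuous functions over the momentum grid of the torus converge

Topic `Probability/LatticeModels`; companion of `LatticeGreenRiemannSum.lean`, whose grid-cell
tiling of the Brillouin zone `[-π,π)^d` (`gridStep L = 2π/L`, `cellCorner j = -π + (2π/L) j`,
`gridCell j`, `iUnion_gridCell`, `pairwise_disjoint_gridCell`, `volume_gridCell_toReal`,
`card_torusSite`) it reuses. That file and `XYOrderRiemannSumProofs.lean` treat two SINGULAR
integrands (`‖p‖⁻²`, `‖p‖⁻¹`) by dominated convergence; the elementary continuous case — the one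
needed to pass from momentum sums `L^{-d} Σ_{k ∈ (ℤ/Lℤ)^d} F(2πk/L)` of finite-volume free
lattice models to Brillouin-zone integrals `(2π)^{-d} ∫ F` (Friedli–Velenik 2017, §10.5.2, (10.41);
Benfatto–Giuliani–Mastropietro 2006, eqs. (1.4) and (2.4): the free propagator "in the limit
`L → ∞`") — was missing and is PROVED here, for functions with values in any real Banach space:

* `cornerRiemannSum G L = (2π/L)^d Σ_{j ∈ (ℤ/Lℤ)^d} G(cellCorner j)` (junk `0` at `L = 0`);
* `tendsto_cornerRiemannSum` — for `G` continuous on `[-π,π]^d`,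
  `cornerRiemannSum G L → ∫_{[-π,π]^d} G` as `L → ∞` through all naturals (uniform continuity on
  the compact zone: each cell contributes at most `δ^d ω_G(δ)`, and there are `L^d = (2π/δ)^d`
  cells);
* helpers: `dist_cellCorner_le_of_mem_gridCell` (a cell has sup-norm radius `δ` about its
  corner), `smul_eq_setIntegral_const`, `setIntegral_brillouin_eq_sum_gridCell'` (vector-valued
  tiling of the Brillouin integral).

## Mathlib / tree search

Mathlib has box-integral Riemann sums (`BoxIntegral`) but no ready statement for the uniform
grid along `L → ∞`; `IsCompact.uniformContinuousOn_of_continuous`,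
`norm_setIntegral_le_of_norm_le_const`, `integral_iUnion_fintype` are used. Tree: the cell
infrastructure listed above (`lean search 'cornerRiemannSum|riemannSum.*tendsto'`: only the two
singular special cases).

## References

* S. Friedli, Y. Velenik, *Statistical Mechanics of Lattice Systems* (CUP 2017), §10.5.2 (the
  reciprocal torus `𝕋*_L = (2π/L){0,…,L-1}^d` and the Fourier modes; after (10.40): «The reader can
  recognize a Riemann sum on the right-hand side, which implies that» (10.41), the momentum sum over
  `p ∈ 𝕋*_L ∖ {0}` passing to `∫_{[-π,π]^d}`). [FriedliVelenikSMLS2017]  (DOCFIX 2026-08-19: earlier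
  versions located this at Section 10.4, which is the Chessboard Estimate — held text checked.)
* G. Benfatto, A. Giuliani, V. Mastropietro, Ann. Henri Poincaré 7 (2006) 809, eqs. (1.4), (2.4).
  [BenfattoGiulianiMastropietro2006]
-/

noncomputable section

namespace Literature.Probability.LatticeModels

open MeasureTheory Filter Topology Finset Real

variable {d : ℕ} {E : Type*} [NormedAddCommGroup E] [NormedSpace ℝ E] [CompleteSpace E]

/-- The corner Riemann sum of `G` over the `L^d` grid cells of `[-π,π)^d`:
`δ^d Σ_j G(c_j)`, `δ = 2π/L`, `c_j = -π + δ j` (junk `0` for `L = 0`). [folklore] -/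
def cornerRiemannSum (G : (Fin d → ℝ) → E) (L : ℕ) : E :=
  if h : L = 0 then 0
  else
    haveI : NeZero L := ⟨h⟩
    ∑ j : TorusSite d L, (gridStep L) ^ d • G (cellCorner j)

omit [CompleteSpace E] in
/-- `cornerRiemannSum` for `L ≠ 0`. [folklore] -/
theorem cornerRiemannSum_eq (G : (Fin d → ℝ) → E) (L : ℕ) [NeZero L] :
    cornerRiemannSum G L = ∑ j : TorusSite d L, (gridStep L) ^ d • G (cellCorner j) := by
  rw [cornerRiemannSum, dif_neg (NeZero.ne L)]

/-- Two points of a grid cell are within `δ` of its corner in every coordinate, hence in the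
sup norm: `dist p c_j ≤ δ`. [folklore] -/
theorem dist_cellCorner_le_of_mem_gridCell {L : ℕ} [NeZero L] {j : TorusSite d L}
    {p : Fin d → ℝ} (hp : p ∈ gridCell j) : dist p (cellCorner j) ≤ gridStep L := by
  rw [dist_pi_le_iff (gridStep_pos L).le]
  intro i
  obtain ⟨h1, h2⟩ := hp i (Set.mem_univ i)
  rw [Real.dist_eq, abs_le]
  constructor <;> linarith

/-- The term of the corner Riemann sum is the integral of the constant `G(c_j)` over the cell.
[folklore] -/
theorem smul_eq_setIntegral_const {L : ℕ} [NeZero L] (j : TorusSite d L) (v : E) :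
    (gridStep L) ^ d • v = ∫ _ in gridCell j, v := by
  rw [setIntegral_const, Measure.real, volume_gridCell_toReal]

omit [CompleteSpace E] in
/-- **Tiling of the Brillouin integral** (vector-valued version of
`setIntegral_brillouin_eq_sum_gridCell`): `∫_{[-π,π]^d} g = Σ_j ∫_{cell_j} g`. [folklore] -/
theorem setIntegral_brillouin_eq_sum_gridCell' (L : ℕ) [NeZero L] {g : (Fin d → ℝ) → E}
    (hg : IntegrableOn g (brillouin d) volume) :
    ∫ p in brillouin d, g p = ∑ j : TorusSite d L, ∫ p in gridCell j, g p := by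
  rw [← setIntegral_congr_set (halfOpenBrillouin_ae_eq_brillouin d), ← iUnion_gridCell d L,
    integral_iUnion_fintype (fun j => measurableSet_gridCell j) (pairwise_disjoint_gridCell d L)]
  exact fun j => hg.mono_set
    ((gridCell_subset_halfOpenBrillouin j).trans (halfOpenBrillouin_subset_brillouin d))

/-- **Riemann sums of a continuous function converge to its integral**: for `G` continuous on
`[-π,π]^d`, `δ^d Σ_{j ∈ (ℤ/Lℤ)^d} G(-π + δj) → ∫_{[-π,π]^d} G` as `L → ∞` (`δ = 2π/L`), by uniform
continuity on the compact Brillouin zone ("passing from sums to integrals" for the momentum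
sums of finite-volume lattice models: Friedli–Velenik 2017, §10.5.2 (10.41); BGM 2006, eqs. (1.4), (2.4)).
[folklore] -/
theorem tendsto_cornerRiemannSum {G : (Fin d → ℝ) → E} (hG : ContinuousOn G (brillouin d)) :
    Tendsto (cornerRiemannSum G) atTop (𝓝 (∫ p in brillouin d, G p)) := by
  have hint : IntegrableOn G (brillouin d) volume :=
    hG.integrableOn_compact (isCompact_brillouin d)
  have huc : UniformContinuousOn G (brillouin d) :=
    (isCompact_brillouin d).uniformContinuousOn_of_continuous hG
  rw [Metric.tendsto_atTop]
  intro ε hε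
  -- uniform continuity with tolerance `ε' = ε / (2 (2π)^d)`
  have h2π : (0 : ℝ) < (2 * π) ^ d := by positivity
  set ε' : ℝ := ε / (2 * (2 * π) ^ d) with hε'
  have hε'pos : 0 < ε' := by positivity
  obtain ⟨η, hη, hηG⟩ := Metric.uniformContinuousOn_iff.1 huc ε' hε'pos
  -- `δ = 2π/L < η` for `L ≥ N`
  obtain ⟨N, hN⟩ := exists_nat_gt (2 * π / η)
  refine ⟨max N 1, fun L hL => ?_⟩
  have hL1 : 1 ≤ L := le_of_max_le_right hL
  haveI : NeZero L := ⟨by omega⟩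
  have hLpos : (0 : ℝ) < L := by exact_mod_cast hL1
  have hδη : gridStep L < η := by
    have hNL : (N : ℝ) ≤ L := by exact_mod_cast le_of_max_le_left hL
    unfold gridStep
    rw [div_lt_iff₀ hLpos]
    calc 2 * π = 2 * π / η * η := by field_simp
      _ < N * η := by gcongr
      _ ≤ L * η := by gcongr
      _ = η * L := mul_comm _ _
  -- cellwise estimate
  have hcell : ∀ j : TorusSite d L,
      ‖(gridStep L) ^ d • G (cellCorner j) - ∫ p in gridCell j, G p‖ ≤ ε' * (gridStep L) ^ d := by
    intro j
    have hsub : gridCell j ⊆ brillouin d := gridCell_subset_brillouin j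
    have hintj : IntegrableOn G (gridCell j) volume := hint.mono_set hsub
    have hvol : volume.real (gridCell j) = gridStep L ^ d := by
      rw [Measure.real, volume_gridCell_toReal]
    have hc : IntegrableOn (fun _ : Fin d → ℝ => G (cellCorner j)) (gridCell j) volume :=
      integrableOn_const (hs := (volume_gridCell_lt_top j).ne)
    rw [smul_eq_setIntegral_const j, ← integral_sub hc hintj, ← hvol]
    refine norm_setIntegral_le_of_norm_le_const (volume_gridCell_lt_top j) fun p hp => ?_
    rw [← dist_eq_norm, dist_comm]
    exact (hηG p (hsub hp) (cellCorner j) (hsub (cellCorner_mem_gridCell j))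
      ((dist_cellCorner_le_of_mem_gridCell hp).trans_lt hδη)).le
  -- sum the cellwise estimates
  rw [dist_eq_norm, cornerRiemannSum_eq, setIntegral_brillouin_eq_sum_gridCell' L hint,
    ← Finset.sum_sub_distrib]
  calc ‖∑ j : TorusSite d L, ((gridStep L) ^ d • G (cellCorner j) - ∫ p in gridCell j, G p)‖
      ≤ ∑ j : TorusSite d L, ‖(gridStep L) ^ d • G (cellCorner j) - ∫ p in gridCell j, G p‖ :=
        norm_sum_le _ _
    _ ≤ ∑ _j : TorusSite d L, ε' * (gridStep L) ^ d := Finset.sum_le_sum fun j _ => hcell j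
    _ = ε' * (2 * π) ^ d := by
        rw [Finset.sum_const, Finset.card_univ, card_torusSite, nsmul_eq_mul, ← gridStep_mul L,
          mul_pow]
        push_cast
        ring
    _ < ε := by
        rw [hε']
        field_simp
        linarith

end Literature.Probability.LatticeModels
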